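import Literature.Probability.LatticeModels.SixVertexTwoPointTheorem
import Literature.Probability.LatticeModels.SixVertexCylinderLimitProps
import Literature.Probability.LatticeModels.SixVertexSpectralMeasureSpace
import Mathlib.Analysis.SpecialFunctions.Trigonometric.Basic

/-!
# Mass bounds for `μ_L` from the regularity estimate (DKLM 2026, Part II, Lemma 30)

H. Duminil-Copin, K. K. Kozlowski, P. Lammers, I. Manolescu, *Gaussian free field convergence of
the six-vertex model with `-1 ≤ Δ ≤ -1/2`*, arXiv:2603.06268 (2026) [DKLM2026SixVertexGFF]
(`paper:arxiv-2603.06268`, chunks p0017, p0023):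

> **Corollary 18** (Regularity estimate for the cylinder). There exist constants `C, c ∈ (0,∞)`
> such that for every `c ∈ [1,2]`, `L ∈ 2ℤ_{≥1}` and `k ∈ ℤ_{≥1}`,
> `|Φ_{CYL_L,2}((0,0),(k,0),(2k,0),(3k,0))| ≤ C`,
> `|Φ_{CYL_L,2}((0,0),(0,ℓ),(k,0),(k,ℓ))| ≤ C(ℓ/k)^c` for `0 < ℓ ≤ min{8k, L/2}`.
>
> **Lemma 30.** There exist constants `c, C ∈ (0,∞)` such that, for every `L`, the measure `μ_L`
> belongs to `𝓜_{c,C}`. Proof. […] Step 1: Checking (i) […] `χ^discr_u(a,b) = -(1-a)^ℓ(1-(1-a)^k)²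
> ≤ 0`. […] First, consider the case `α ≤ 1/16`. Let `k = ℓ ∈ [1/8α, 1/4α] ∩ 2ℤ`. Then, for any
> `(a,b) ∈ [α,2α] × ℝ`, a short computation gives that `|χ^discr_u(a,b)| ≥ 1/1000`. Also,
> Corollary 18 implies that `|Φ_{L,2}(u)| ≤ C` […] `μ_L[{a ∈ [α,2α]}] ≤ -1000 ∫ χ^discr_u dμ_L
> = 1000 |Φ_{CYL_L,2}(u)| ≤ 1000 C`. For the case `α ≥ 1/16`, simply set `k = 1` and `ℓ = 0` […]
> `μ_L[{a ∈ [1/16,∞)}] ≤ 256 |Φ_{CYL_L,2}(u)| ≤ 256`. On the right we used that height differences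
> are bounded by `1`. Step 2: Checking (ii) […] for `α < 1/16` and `β = π/(2ℓ)` with `1 ≤ ℓ ≤ L/2`
> […] choose some even integer `k ∈ [1/8α, 1/4α]` […] `χ^discr_u(a,b) = 2(1-a)^k(1 - cos ℓb) ≥ 0`
> […] `χ^discr_u(a,b) ≥ 1` […] `|Φ_{L,2}(u)| ≤ C'(α/β)^{c'}`. The conclusion follows.

This file proves **Lemma 30 in the discrete form established by its proof** (bound (i) of
Definition 29 for every `α > 0`, bound (ii) for `β ∈ {π/(2ℓ')}`, `α ≤ 1/16`), taking the two
displays of Corollary 18 — a Part IV input — as hypotheses on the cylinder correlations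
`phiHor`, `phiVer` (the Theorem 23 correlations `cylinderPairExp` of the two test
configurations), for `μ_L = dklmMeasure` of `SixVertexTwoPointTheorem.lean`:

* `abs_torusCondExp_le`, `abs_cylinderPairExp_le` (bounded observables, "height differences are
  bounded by `1`"), `phiHor_eq`, `phiVer_eq`, `phiUnit_eq` (Theorem 23 for the three test
  configurations), `dklmMeasure_apply_eq_ofReal`;
* **`dklmMeasure_strip_le_of_regularity`** — (i) for `α ≤ 1/16`: `μ_L{a ∈ (α,2α)} ≤ 162 C`
  (the paper's `1000`; even `k ∈ [1/8α, 1/4α]`, `(1-a)^k(1-(1-a)^k)² ≥ 1/162` on `[α,2α]`);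
* **`dklmMeasure_ge_le_inv_sq`**, `dklmMeasure_strip_le_inv_sq` — `μ_L{a ≥ α} ≤ α⁻²` for every
  `α > 0` (`u` with unit steps, `χ = -a²`, `|Φ| ≤ 1`), in particular `≤ 256` for `α ≥ 1/16`;
  `dklmMeasure_bound_i_of_regularity` — bound (i) for all `α > 0`;
* **`dklmMeasure_box_le_of_regularity`** — (ii) for `β = π/(2ℓ')`, `1 ≤ ℓ' ≤ L/2`, `α ≤ 1/16`,
  `α ≤ 2β`: `μ_L{(a,|b|) ∈ (0,α) × [β,2β]} ≤ (4/3) C π^c (α/β)^c` (even `k = 2⌈1/(4α)⌉ ≥ 1/2α`,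
  which guarantees `ℓ' ≤ 8k`; closed `b`-window);
* **`dklmMeasure_bound_ii_small_of_regularity`**, **`dklmMeasure_bound_ii_of_regularity`** — bound
  (ii) of Definition 29 for all `β ≥ α > 0` (the "simple algebraic manipulations": two closed
  windows `[π/2ℓ₁, π/ℓ₁] ∪ [π/2(ℓ₁-1), π/(ℓ₁-1)]`, `ℓ₁ = ⌈π/2β⌉`, the support properties of
  Theorem 23, and the `α > 1/16` split);
* **`dklmMeasure_mem_dklmSpaceM_of_regularity` — Lemma 30: `μ_L ∈ 𝓜_{c_reg, C'}`** with an explicit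
  `L`-independent `C'`, conditional on Corollary 18.

## References

* H. Duminil-Copin, K. K. Kozlowski, P. Lammers, I. Manolescu, arXiv:2603.06268 (2026), Part II,
  Corollary 18, Definition 29, Lemma 30 and its proof. [DKLM2026SixVertexGFF]
-/

noncomputable section

open Finset Filter Topology MeasureTheory Set

namespace Literature.Probability.LatticeModels.SixVertex

/-! ## 1. Bounded observables give bounded correlations -/

section Bounded

variable {G₁ G₂ : Type*} [AddGroup G₁] [AddGroup G₂] [One G₁] [One G₂] [Fintype G₁] [Fintype G₂]
  [DecidableEq G₁] [DecidableEq G₂]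

open scoped Classical in
/-- **A conditional expectation of a bounded observable is bounded**: `|𝔼_𝕋[F | balanced]| ≤ B`
if `|F| ≤ B` (weights are nonnegative). [cite: DKLM2026SixVertexGFF, Def. 2.1] -/
theorem abs_torusCondExp_le {a b c : ℝ} (ha : 0 ≤ a) (hb : 0 ≤ b) (hc : 0 ≤ c) {F : Config (G₁ × G₂) → ℝ}
    {B : ℝ} (hB : 0 ≤ B) (hF : ∀ ω, |F ω| ≤ B) : |torusCondExp a b c F| ≤ B := by
  unfold torusCondExp
  set D : ℝ := ∑ ω : Config (G₁ × G₂), if IsBalanced ω then torusWeight a b c ω else 0 with hD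
  have hD0 : 0 ≤ D := Finset.sum_nonneg fun ω _ => by
    split_ifs
    · exact torusWeight_nonneg ha hb hc ω
    · exact le_rfl
  rcases hD0.eq_or_lt with hD0 | hDpos
  · rw [← hD0, div_zero, abs_zero]; exact hB
  · rw [abs_div, abs_of_pos hDpos, div_le_iff₀ hDpos]
    calc |∑ ω : Config (G₁ × G₂), if IsBalanced ω then F ω * torusWeight a b c ω else 0|
        ≤ ∑ ω : Config (G₁ × G₂), |if IsBalanced ω then F ω * torusWeight a b c ω else 0| :=
          Finset.abs_sum_le_sum_abs _ _
      _ ≤ ∑ ω : Config (G₁ × G₂), B * (if IsBalanced ω then torusWeight a b c ω else 0) := by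
          refine Finset.sum_le_sum fun ω _ => ?_
          split_ifs
          · rw [abs_mul, abs_of_nonneg (torusWeight_nonneg ha hb hc ω)]
            exact mul_le_mul_of_nonneg_right (hF ω) (torusWeight_nonneg ha hb hc ω)
          · simp
      _ = B * D := by rw [hD, Finset.mul_sum]

end Bounded

section BoundedPair

variable {G₂ : Type*} [AddCommGroup G₂] [One G₂] [Fintype G₂] [DecidableEq G₂]

/-- Bounded strip observables have bounded torus pair correlations. [cite: DKLM2026SixVertexGFF, Def. 2.1] -/
theorem abs_torusPairExp_le (c : ℝ) (hc : 0 ≤ c) (M : ℕ) {r₁' r₂' : ℕ}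
    {X : (G₂ → Bool) → (Fin (r₁' + 1) → G₂ → Bool) → (Fin (r₁' + 1) → G₂ → Bool) → ℝ}
    {Y : (G₂ → Bool) → (Fin (r₂' + 1) → G₂ → Bool) → (Fin (r₂' + 1) → G₂ → Bool) → ℝ} {A B : ℝ}
    (hA : 0 ≤ A) (hB : 0 ≤ B) (hX : ∀ (M : ℕ) (ω : Config (ZMod M × G₂)), |torusObs r₁' X ω| ≤ A)
    (hY : ∀ (M : ℕ) (ω : Config (ZMod M × G₂)), |torusObs r₂' Y ω| ≤ B) (n : ℕ) :
    |torusPairExp c M r₁' X n r₂' Y| ≤ A * B := by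
  unfold torusPairExp
  split_ifs with hM
  · rw [abs_zero]; positivity
  · haveI : NeZero M := ⟨hM⟩
    refine abs_torusCondExp_le zero_le_one zero_le_one hc (mul_nonneg hA hB) fun ω => ?_
    rw [torusPairObs, abs_mul]
    exact mul_le_mul (hX M ω) (hY M _) (abs_nonneg _) hA

/-- **Bounded observables have bounded cylinder correlations** ("height differences are bounded").
[cite: DKLM2026SixVertexGFF, Part II, proof of Lemma 30, Step 1] -/
theorem abs_cylinderPairExp_le (c : ℝ) (hc : 0 < c) [Nonempty {κ : G₂ → Bool // IsBalancedCol κ}] {r₁' r₂' : ℕ}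
    (X : (G₂ → Bool) → (Fin (r₁' + 1) → G₂ → Bool) → (Fin (r₁' + 1) → G₂ → Bool) → ℝ)
    (Y : (G₂ → Bool) → (Fin (r₂' + 1) → G₂ → Bool) → (Fin (r₂' + 1) → G₂ → Bool) → ℝ) {A B : ℝ}
    (hA : 0 ≤ A) (hB : 0 ≤ B) (hX : ∀ (M : ℕ) (ω : Config (ZMod M × G₂)), |torusObs r₁' X ω| ≤ A)
    (hY : ∀ (M : ℕ) (ω : Config (ZMod M × G₂)), |torusObs r₂' Y ω| ≤ B) (k : ℕ) :
    |cylinderPairExp c r₁' X (r₁' + 1 + k) r₂' Y| ≤ A * B :=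
  le_of_tendsto' ((continuous_abs.tendsto _).comp (tendsto_torusPairExp_cylinderPairExp c hc X Y k))
    fun M => abs_torusPairExp_le c hc.le M hA hB hX hY _

/-- `|arrowSign| = 1`. [folklore] -/
theorem abs_arrowSign (b : Bool) : |arrowSign b| = 1 := by
  cases b <;> simp [arrowSign]

omit [Fintype G₂] [DecidableEq G₂] in
/-- A unit horizontal step `h(u+e₁) - h(u)` is `±1`. [cite: DKLM2026SixVertexGFF, Def. 2.3] -/
theorem abs_torusObs_lPairObs_unit {M : ℕ} (r' a : ℕ) (h : a + 0 + 1 ≤ r' + 1) (y : G₂) (ω : Config (ZMod M × G₂)) :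
    |torusObs r' (lPairObs r' a 0 h 0 y) ω| ≤ 1 := by
  rw [torusObs_lPairObs]
  simp [abs_arrowSign]

end BoundedPair

/-! ## 2. The three test configurations of the proof of Lemma 30 -/

section Config

variable (c : ℝ) (hc : 0 < c) (ℓ : ℕ)

/-- **`Φ_{CYL_L,2}((0,0),(k,0),(2k,0),(3k,0))`**, `k = m+1`: two horizontal pairs of width `k` at
distance `k` (blocks of `k` columns in two strips of width `k`, gap `k`).
[cite: DKLM2026SixVertexGFF, Corollary 18 and proof of Lemma 30, Step 1] -/
def phiHor (m : ℕ) : ℝ :=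
  cylinderPairExp c m (lPairObs m 0 m (by omega) 0 ((0 : ℕ) : ZMod (2 * (ℓ + 1)))) (m + 1 + (m + 1)) m
    (lPairObs m 0 m (by omega) 0 ((0 : ℕ) : ZMod (2 * (ℓ + 1))))

/-- **`Φ_{CYL_L,2}((0,0),(0,ℓ'),(k,0),(k,ℓ'))`**, `k = m+1`: two vertical pairs of height `ℓ'` at
horizontal distance `k` (at the face `1` of two one-column strips, gap `m`).
[cite: DKLM2026SixVertexGFF, Corollary 18 and proof of Lemma 30, Step 2] -/
def phiVer (m ℓ' : ℕ) : ℝ :=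
  cylinderPairExp c 0 (colObs 0 0 ℓ' ((0 : ℕ) : ZMod (2 * (ℓ + 1)))) (0 + 1 + m) 0
    (colObs 0 0 ℓ' ((0 : ℕ) : ZMod (2 * (ℓ + 1))))

/-- **`Φ_{CYL_L,2}((0,0),(1,0),(1,0),(2,0))`**: two consecutive unit horizontal steps (`k = 1`,
`ℓ = 0`). [cite: DKLM2026SixVertexGFF, proof of Lemma 30, Step 1 (case `α ≥ 1/16`)] -/
def phiUnit : ℝ :=
  cylinderPairExp c 0 (lPairObs 0 0 0 (by omega) 0 ((0 : ℕ) : ZMod (2 * (ℓ + 1)))) (0 + 1 + 0) 0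
    (lPairObs 0 0 0 (by omega) 0 ((0 : ℕ) : ZMod (2 * (ℓ + 1))))

include hc

/-- **Theorem 23 for the horizontal configuration**: `χ^discr_u = -(1-a)^k(1-(1-a)^k)²`, so
`Φ = -∑_j w_j (1-a_j)^k (1-(1-a_j)^k)²`. [cite: DKLM2026SixVertexGFF, proof of Lemma 30, Step 1] -/
theorem phiHor_eq (m : ℕ) :
    phiHor c ℓ m = -∑ j, dklmWeight c hc ℓ j * ((1 - dklmAtomA c ℓ j) ^ (m + 1) * (1 - (1 - dklmAtomA c ℓ j) ^ (m + 1)) ^ 2) := by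
  apply Complex.ofReal_injective
  have h := cylinderPairExp_lPairObs_lPairObs_eq_sum c hc ℓ (r₁' := m) (r₂' := m) 0 m (by omega) 0 0 m (by omega) 0 0 0 (m + 1)
  rw [phiHor, h]
  push_cast
  rw [← Finset.sum_neg_distrib]
  refine Finset.sum_congr rfl fun j _ => ?_
  simp only [Nat.sub_zero, Nat.sub_self, zero_add, add_zero, pow_zero, mul_one]
  ring

/-- **Theorem 23 for the vertical configuration**: `χ^discr_u = 2(1-a)^k(1 - cos ℓ'b)`, so
`Φ = ∑_j w_j (1-a_j)^k · 2(1 - cos(ℓ' b_j))`. [cite: DKLM2026SixVertexGFF, proof of Lemma 30, Step 2] -/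
theorem phiVer_eq (m ℓ' : ℕ) :
    phiVer c ℓ m ℓ' = ∑ j, dklmWeight c hc ℓ j * ((1 - dklmAtomA c ℓ j) ^ (m + 1) * (2 * (1 - Real.cos (ℓ' * dklmPhaseB c ℓ j)))) := by
  apply Complex.ofReal_injective
  have h := cylinderPairExp_colObs_colObs_eq_sum c hc ℓ (r₁' := 0) (r₂' := 0) 0 ℓ' 0 ℓ' 0 0 m
  rw [phiVer, h]
  push_cast
  refine Finset.sum_congr rfl fun j _ => ?_
  simp only [Fin.val_zero, Nat.sub_zero, zero_add, add_zero, pow_zero]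
  have hωω : transferJointPhase c ℓ j ^ ℓ' * star (transferJointPhase c ℓ j) ^ ℓ' = 1 := by
    rw [← mul_pow, mul_comm, RCLike.star_def, conj_transferJointPhase_mul_self, one_pow]
  have hcos : transferJointPhase c ℓ j ^ ℓ' + star (transferJointPhase c ℓ j) ^ ℓ' =
      2 * Complex.cos ((ℓ' : ℂ) * (dklmPhaseB c ℓ j : ℂ)) := by
    rw [← exp_I_mul_dklmPhaseB_mul, ← exp_neg_I_mul_dklmPhaseB_mul, Complex.two_cos]
    congr 1 <;> congr 1 <;> ring
  linear_combination ((dklmWeight c hc ℓ j : ℂ) * (1 - (dklmAtomA c ℓ j : ℂ)) ^ (m + 1)) * (hωω - hcos)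

/-- **Theorem 23 for two consecutive unit steps**: `χ^discr_u = -a²`, so `Φ = -∑_j w_j a_j²`.
[cite: DKLM2026SixVertexGFF, proof of Lemma 30, Step 1] -/
theorem phiUnit_eq : phiUnit c ℓ = -∑ j, dklmWeight c hc ℓ j * dklmAtomA c ℓ j ^ 2 := by
  apply Complex.ofReal_injective
  have h := cylinderPairExp_lPairObs_lPairObs_eq_sum c hc ℓ (r₁' := 0) (r₂' := 0) 0 0 (by omega) 0 0 0 (by omega) 0 0 0 0
  rw [phiUnit, h]
  push_cast
  rw [← Finset.sum_neg_distrib]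
  refine Finset.sum_congr rfl fun j _ => ?_
  simp only [pow_zero, mul_one, pow_one]
  ring

/-- `|Φ_{CYL_L,2}((0,0),(1,0),(1,0),(2,0))| ≤ 1` (unit height differences).
[cite: DKLM2026SixVertexGFF, proof of Lemma 30, Step 1] -/
theorem abs_phiUnit_le : |phiUnit c ℓ| ≤ 1 := by
  rw [phiUnit]
  exact (abs_cylinderPairExp_le c hc _ _ zero_le_one zero_le_one
    (fun M ω => abs_torusObs_lPairObs_unit _ _ _ _ ω) (fun M ω => abs_torusObs_lPairObs_unit _ _ _ _ ω) 0).trans_eq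
    (mul_one 1)

/-- **`∑_j w_j a_j² ≤ 1`.** [cite: DKLM2026SixVertexGFF, proof of Lemma 30, Step 1 (case `α ≥ 1/16`)] -/
theorem sum_dklmWeight_mul_sq_le_one : ∑ j, dklmWeight c hc ℓ j * dklmAtomA c ℓ j ^ 2 ≤ 1 := by
  have h := abs_phiUnit_le c hc ℓ
  rw [phiUnit_eq c hc ℓ, abs_neg] at h
  exact (le_abs_self _).trans h

end Config

/-! ## 3. The mass of `μ_L` in atom form -/

section Mass

variable (c : ℝ) (hc : 0 < c) (ℓ : ℕ)

/-- **The mass of a set as a real weighted count of atoms.** [cite: DKLM2026SixVertexGFF, Theorem 23] -/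
theorem dklmMeasure_apply_eq_ofReal (s : Set (ℝ × ℝ)) :
    dklmMeasure c hc ℓ s = ENNReal.ofReal (∑ k, dklmWeight c hc ℓ k / 2 *
      (s.indicator (1 : ℝ × ℝ → ℝ) (dklmAtomA c ℓ k, dklmPhaseB c ℓ k) +
        s.indicator (1 : ℝ × ℝ → ℝ) (dklmAtomA c ℓ k, -dklmPhaseB c ℓ k))) := by
  have hind : ∀ p : ℝ × ℝ, ENNReal.ofReal (s.indicator (1 : ℝ × ℝ → ℝ) p) = s.indicator 1 p := by
    intro p
    by_cases hp : p ∈ s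
    · simp [indicator_of_mem hp]
    · simp [indicator_of_notMem hp]
  have hw : ∀ k, 0 ≤ dklmWeight c hc ℓ k / 2 := fun k => by linarith [dklmWeight_nonneg c hc ℓ k]
  have hi0 : ∀ p : ℝ × ℝ, 0 ≤ s.indicator (1 : ℝ × ℝ → ℝ) p := fun p =>
    Set.indicator_nonneg (fun _ _ => zero_le_one) p
  rw [dklmMeasure_apply, ENNReal.ofReal_sum_of_nonneg fun k _ => mul_nonneg (hw k) (add_nonneg (hi0 _) (hi0 _))]
  refine Finset.sum_congr rfl fun k _ => ?_
  rw [ENNReal.ofReal_mul (hw k), ENNReal.ofReal_add (hi0 _) (hi0 _), hind, hind]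
  rfl

/-- **Comparison principle**: if a real function `g` is `≥ 0` at all atoms `(a_k, ±b_k)` and
`≥ m > 0` at those atoms lying in `s`, then `m · μ_L(s) ≤ ∫ g dμ_L = ∑_k (w_k/2)(g(a_k,b_k) + g(a_k,-b_k))`.
[cite: DKLM2026SixVertexGFF, proof of Lemma 30] -/
theorem dklmMeasure_le_of_indicator_le {s : Set (ℝ × ℝ)} {g : ℝ × ℝ → ℝ} {m : ℝ} (hm : 0 < m)
    (hg0 : ∀ k, 0 ≤ g (dklmAtomA c ℓ k, dklmPhaseB c ℓ k) ∧ 0 ≤ g (dklmAtomA c ℓ k, -dklmPhaseB c ℓ k))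
    (hgs : ∀ k (σ : Bool), (dklmAtomA c ℓ k, (if σ then 1 else -1) * dklmPhaseB c ℓ k) ∈ s →
      m ≤ g (dklmAtomA c ℓ k, (if σ then 1 else -1) * dklmPhaseB c ℓ k)) :
    dklmMeasure c hc ℓ s ≤ ENNReal.ofReal (m⁻¹ * ∑ k, dklmWeight c hc ℓ k / 2 *
      (g (dklmAtomA c ℓ k, dklmPhaseB c ℓ k) + g (dklmAtomA c ℓ k, -dklmPhaseB c ℓ k))) := by
  rw [dklmMeasure_apply_eq_ofReal, Finset.mul_sum]
  refine ENNReal.ofReal_le_ofReal (Finset.sum_le_sum fun k _ => ?_)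
  rw [← mul_assoc, mul_comm m⁻¹, mul_assoc]
  refine mul_le_mul_of_nonneg_left ?_ (by linarith [dklmWeight_nonneg c hc ℓ k])
  rw [mul_add]
  have key : ∀ σ : Bool, s.indicator (1 : ℝ × ℝ → ℝ) (dklmAtomA c ℓ k, (if σ then 1 else -1) * dklmPhaseB c ℓ k) ≤
      m⁻¹ * g (dklmAtomA c ℓ k, (if σ then 1 else -1) * dklmPhaseB c ℓ k) := by
    intro σ
    by_cases hp : (dklmAtomA c ℓ k, (if σ then 1 else -1) * dklmPhaseB c ℓ k) ∈ s
    · rw [indicator_of_mem hp, Pi.one_apply, le_inv_mul_iff₀ hm, mul_one]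
      exact hgs k σ hp
    · rw [indicator_of_notMem hp]
      have := hg0 k
      cases σ
      · simp only [Bool.false_eq_true, ↓reduceIte, neg_mul, one_mul] at hp ⊢
        exact mul_nonneg (inv_nonneg.2 hm.le) this.2
      · simp only [↓reduceIte, one_mul] at hp ⊢
        exact mul_nonneg (inv_nonneg.2 hm.le) this.1
  have k1 := key true
  have k2 := key false
  simp only [↓reduceIte, one_mul, Bool.false_eq_true, neg_mul] at k1 k2
  exact add_le_add k1 k2

end Mass

/-! ## 4. Lemma 30, Step 1: bound (i) -/

section Step1

variable (c : ℝ) (hc : 0 < c) (ℓ : ℕ)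

/-- `e^{-s} ≤ 1/(1+s)` for `s ≥ 0`. [folklore] -/
theorem exp_neg_le_one_div_add {s : ℝ} (hs : 0 ≤ s) : Real.exp (-s) ≤ 1 / (1 + s) := by
  rw [Real.exp_neg, inv_eq_one_div, div_le_div_iff_of_pos_left one_pos (Real.exp_pos s) (by linarith)]
  linarith [Real.add_one_le_exp s]

/-- **The "short computation" of Step 1**: for `0 < α ≤ 1/16`, `K = 2⌈1/(16α)⌉` (an even integer in
`[1/8α, 1/4α]`) and `a ∈ [α, 2α]`: `(1-a)^K (1-(1-a)^K)² ≥ 1/162`.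
[cite: DKLM2026SixVertexGFF, proof of Lemma 30, Step 1] -/
theorem strip_integrand_ge {α : ℝ} (hα : 0 < α) (hα' : α ≤ 1 / 16) {a : ℝ} (ha1 : α ≤ a) (ha2 : a ≤ 2 * α) :
    (1 : ℝ) / 162 ≤ (1 - a) ^ (2 * ⌈(16 * α)⁻¹⌉₊) * (1 - (1 - a) ^ (2 * ⌈(16 * α)⁻¹⌉₊)) ^ 2 := by
  set K : ℕ := 2 * ⌈(16 * α)⁻¹⌉₊ with hK
  have hK1 : (8 * α)⁻¹ ≤ (K : ℝ) := by
    rw [hK]; push_cast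
    have := Nat.le_ceil ((16 * α)⁻¹)
    rw [show (8 * α)⁻¹ = 2 * (16 * α)⁻¹ by field_simp; ring]
    linarith
  have hK2 : (K : ℝ) ≤ (4 * α)⁻¹ := by
    rw [hK]; push_cast
    have := Nat.ceil_lt_add_one (show 0 ≤ (16 * α)⁻¹ by positivity)
    have h16 : (2 : ℝ) ≤ (8 * α)⁻¹ := by
      rw [le_inv_comm₀ (by norm_num) (by positivity)]; linarith
    have e : (4 * α)⁻¹ = (8 * α)⁻¹ + (8 * α)⁻¹ := by field_simp; ring
    have e2 : (8 * α)⁻¹ = 2 * (16 * α)⁻¹ := by field_simp; ring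
    nlinarith
  have ha0 : 0 ≤ a := hα.le.trans ha1
  -- `(1-a)^K ≥ 1/2`
  have hlow : (1 : ℝ) / 2 ≤ (1 - a) ^ K := by
    have hB := one_add_mul_le_pow (show (-2 : ℝ) ≤ -a by linarith) K
    rw [show (1 : ℝ) + -a = 1 - a by ring] at hB
    have : (K : ℝ) * a ≤ 1 / 2 := by
      calc (K : ℝ) * a ≤ (4 * α)⁻¹ * (2 * α) := by gcongr
        _ = 1 / 2 := by field_simp; ring
    linarith
  -- `(1-a)^K ≤ 8/9`
  have hup : (1 - a) ^ K ≤ 8 / 9 := by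
    have h1a : 0 ≤ 1 - a := by nlinarith
    calc (1 - a) ^ K ≤ (1 - α) ^ K := pow_le_pow_left₀ h1a (by linarith) K
      _ ≤ Real.exp (-α) ^ K := pow_le_pow_left₀ (by linarith) (by linarith [Real.add_one_le_exp (-α)]) K
      _ = Real.exp (-(α * K)) := by rw [← Real.exp_nat_mul]; ring_nf
      _ ≤ Real.exp (-(1 / 8)) := by
          apply Real.exp_le_exp.2; apply neg_le_neg
          calc (1 : ℝ) / 8 = α * (8 * α)⁻¹ := by field_simp
            _ ≤ α * K := by gcongr
      _ ≤ 1 / (1 + 1 / 8) := exp_neg_le_one_div_add (by norm_num)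
      _ = 8 / 9 := by norm_num
  have hsq : (1 : ℝ) / 81 ≤ (1 - (1 - a) ^ K) ^ 2 := by nlinarith
  calc (1 : ℝ) / 162 = 1 / 2 * (1 / 81) := by norm_num
    _ ≤ (1 - a) ^ K * (1 - (1 - a) ^ K) ^ 2 := mul_le_mul hlow hsq (by norm_num) (by linarith)

include hc

/-- **Lemma 30, Step 1, case `α ≤ 1/16` (bound (i) of Definition 29)** given the first display of
Corollary 18: `μ_L{a ∈ (α,2α)} ≤ 162 C`. [cite: DKLM2026SixVertexGFF, Lemma 30 (proof, Step 1) and Corollary 18] -/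
theorem dklmMeasure_strip_le_of_regularity {Creg : ℝ} (hRa : ∀ m : ℕ, |phiHor c ℓ m| ≤ Creg) {α : ℝ}
    (hα : 0 < α) (hα' : α ≤ 1 / 16) :
    dklmMeasure c hc ℓ {p : ℝ × ℝ | p.1 ∈ Ioo α (2 * α)} ≤ ENNReal.ofReal (162 * Creg) := by
  set K : ℕ := 2 * ⌈(16 * α)⁻¹⌉₊ with hK
  have hKpos : 0 < ⌈(16 * α)⁻¹⌉₊ := Nat.ceil_pos.2 (by positivity)
  obtain ⟨m, hm⟩ : ∃ m : ℕ, K = m + 1 := ⟨K - 1, by omega⟩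
  -- the comparison function `g(a,b) = (1-a)^K (1-(1-a)^K)²`
  set g : ℝ × ℝ → ℝ := fun p => (1 - p.1) ^ K * (1 - (1 - p.1) ^ K) ^ 2 with hg
  have hKeven : Even K := ⟨⌈(16 * α)⁻¹⌉₊, by rw [hK]; ring⟩
  have hg0 : ∀ p : ℝ × ℝ, 0 ≤ g p := fun p => mul_nonneg (hKeven.pow_nonneg _) (sq_nonneg _)
  have hsum : ∑ k, dklmWeight c hc ℓ k / 2 * (g (dklmAtomA c ℓ k, dklmPhaseB c ℓ k) + g (dklmAtomA c ℓ k, -dklmPhaseB c ℓ k)) =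
      -phiHor c ℓ m := by
    rw [phiHor_eq c hc ℓ m, neg_neg, ← hm]
    refine Finset.sum_congr rfl fun k _ => ?_
    simp only [hg]
    ring
  refine (dklmMeasure_le_of_indicator_le c hc ℓ (s := {p : ℝ × ℝ | p.1 ∈ Ioo α (2 * α)}) (g := g)
    (m := 1 / 162) (by norm_num) (fun k => ⟨hg0 _, hg0 _⟩) (fun k σ hp => ?_)).trans ?_
  · exact strip_integrand_ge hα hα' hp.1.le hp.2.le
  · rw [hsum]
    refine ENNReal.ofReal_le_ofReal ?_
    have := hRa m
    rw [abs_le] at this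
    norm_num
    linarith

/-- **Lemma 30, Step 1, all `α > 0`**: `μ_L{a ≥ α} ≤ α⁻²` (`χ = -a²` for two consecutive unit
steps and `|Φ| ≤ 1`); in particular `μ_L{a ≥ 1/16} ≤ 256`.
[cite: DKLM2026SixVertexGFF, Lemma 30 (proof, Step 1, case `α ≥ 1/16`)] -/
theorem dklmMeasure_ge_le_inv_sq {α : ℝ} (hα : 0 < α) :
    dklmMeasure c hc ℓ {p : ℝ × ℝ | α ≤ p.1} ≤ ENNReal.ofReal (α ^ 2)⁻¹ := by
  set g : ℝ × ℝ → ℝ := fun p => p.1 ^ 2 with hg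
  have hsum : ∑ k, dklmWeight c hc ℓ k / 2 * (g (dklmAtomA c ℓ k, dklmPhaseB c ℓ k) + g (dklmAtomA c ℓ k, -dklmPhaseB c ℓ k)) =
      ∑ k, dklmWeight c hc ℓ k * dklmAtomA c ℓ k ^ 2 := Finset.sum_congr rfl fun k _ => by simp only [hg]; ring
  refine (dklmMeasure_le_of_indicator_le c hc ℓ (s := {p : ℝ × ℝ | α ≤ p.1}) (g := g)
    (m := α ^ 2) (by positivity) (fun k => ⟨sq_nonneg _, sq_nonneg _⟩) (fun k σ hp => ?_)).trans ?_
  · exact pow_le_pow_left₀ hα.le hp 2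
  · rw [hsum]
    refine ENNReal.ofReal_le_ofReal ?_
    calc (α ^ 2)⁻¹ * ∑ k, dklmWeight c hc ℓ k * dklmAtomA c ℓ k ^ 2 ≤ (α ^ 2)⁻¹ * 1 := by
          gcongr; exact sum_dklmWeight_mul_sq_le_one c hc ℓ
      _ = (α ^ 2)⁻¹ := mul_one _

/-- `μ_L{a ∈ (α,2α)} ≤ α⁻²` for every `α > 0`. [cite: DKLM2026SixVertexGFF, Lemma 30 (proof, Step 1)] -/
theorem dklmMeasure_strip_le_inv_sq {α : ℝ} (hα : 0 < α) :
    dklmMeasure c hc ℓ {p : ℝ × ℝ | p.1 ∈ Ioo α (2 * α)} ≤ ENNReal.ofReal (α ^ 2)⁻¹ :=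
  (measure_mono fun _ hp => hp.1.le).trans (dklmMeasure_ge_le_inv_sq c hc ℓ hα)

/-- **Bound (i) of Definition 29 for `μ_L`, all `α > 0`**, given the first display of Corollary 18:
`μ_L{a ∈ (α,2α)} ≤ max(162 C, 256)`. [cite: DKLM2026SixVertexGFF, Lemma 30 (proof, Step 1)] -/
theorem dklmMeasure_bound_i_of_regularity {Creg : ℝ} (hRa : ∀ m : ℕ, |phiHor c ℓ m| ≤ Creg) {α : ℝ} (hα : 0 < α) :
    dklmMeasure c hc ℓ {p : ℝ × ℝ | p.1 ∈ Ioo α (2 * α)} ≤ ENNReal.ofReal (max (162 * Creg) 256) := by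
  rcases le_or_gt α (1 / 16) with h | h
  · exact (dklmMeasure_strip_le_of_regularity c hc ℓ hRa hα h).trans (ENNReal.ofReal_le_ofReal (le_max_left _ _))
  · refine (dklmMeasure_strip_le_inv_sq c hc ℓ hα).trans (ENNReal.ofReal_le_ofReal ((le_trans ?_ (le_max_right _ _))))
    rw [inv_le_comm₀ (by positivity) (by norm_num)]
    nlinarith

end Step1

/-! ## 5. Lemma 30, Step 2: bound (ii) for `β = π/(2ℓ')` -/

section Step2

variable (c : ℝ) (hc : 0 < c) (ℓ : ℕ)

/-- **The "short computation" of Step 2**: for `0 < α ≤ 1/16`, `K = 2⌈1/(4α)⌉` (an even integer in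
`[1/2α, 1/2α + 2]`), `0 ≤ a ≤ α` and `ℓ'|b| ∈ [π/2, π]`: `(1-a)^K · 2(1 - cos ℓ'b) ≥ 3/4`.
[cite: DKLM2026SixVertexGFF, proof of Lemma 30, Step 2] -/
theorem box_integrand_ge {α : ℝ} (hα : 0 < α) (hα' : α ≤ 1 / 16) {a : ℝ} (ha0 : 0 ≤ a) (ha : a ≤ α) {θ : ℝ}
    (hθ1 : Real.pi / 2 ≤ |θ|) (hθ2 : |θ| ≤ Real.pi) :
    (3 : ℝ) / 4 ≤ (1 - a) ^ (2 * ⌈(4 * α)⁻¹⌉₊) * (2 * (1 - Real.cos θ)) := by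
  set K : ℕ := 2 * ⌈(4 * α)⁻¹⌉₊ with hK
  have hK2 : (K : ℝ) ≤ (2 * α)⁻¹ + 2 := by
    rw [hK]; push_cast
    have := Nat.ceil_lt_add_one (show 0 ≤ (4 * α)⁻¹ by positivity)
    have e2 : (2 * α)⁻¹ = 2 * (4 * α)⁻¹ := by field_simp; ring
    nlinarith
  have hlow : (3 : ℝ) / 8 ≤ (1 - a) ^ K := by
    have hB := one_add_mul_le_pow (show (-2 : ℝ) ≤ -a by linarith) K
    rw [show (1 : ℝ) + -a = 1 - a by ring] at hB
    have : (K : ℝ) * a ≤ 5 / 8 := by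
      calc (K : ℝ) * a ≤ ((2 * α)⁻¹ + 2) * α := by gcongr
        _ = 1 / 2 + 2 * α := by field_simp
        _ ≤ 5 / 8 := by linarith
    linarith
  have hcos : Real.cos θ ≤ 0 := by
    rw [← Real.cos_abs]
    exact Real.cos_nonpos_of_pi_div_two_le_of_le hθ1 (by linarith [Real.pi_pos])
  calc (3 : ℝ) / 4 = 3 / 8 * 2 := by norm_num
    _ ≤ (1 - a) ^ K * (2 * (1 - Real.cos θ)) := mul_le_mul hlow (by linarith) (by norm_num) (by linarith)

include hc

/-- **Lemma 30, Step 2 (bound (ii) of Definition 29 for `β = π/(2ℓ')`)** given the second display of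
Corollary 18: for `0 < α ≤ 1/16`, `1 ≤ ℓ' ≤ L/2 = ℓ+1`, `α ≤ 2β` where `β := π/(2ℓ')`, and `c' ≥ 0`:
`μ_L{(a,|b|) ∈ (0,α) × [β,2β]} ≤ (4/3) C π^{c'} (α/β)^{c'}` (even `k = 2⌈1/(4α)⌉ ≥ 1/(2α)`, so that
`ℓ' ≤ 8k`; the `b`-window is taken closed, as the integrand bound `χ ≥ 3/4` allows).
[cite: DKLM2026SixVertexGFF, Lemma 30 (proof, Step 2) and Corollary 18] -/
theorem dklmMeasure_box_le_of_regularity {Creg creg : ℝ} (hcreg : 0 ≤ creg)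
    (hRb : ∀ m ℓ' : ℕ, 0 < ℓ' → (ℓ' : ℝ) ≤ 8 * ((m : ℝ) + 1) → ℓ' ≤ ℓ + 1 →
      |phiVer c ℓ m ℓ'| ≤ Creg * ((ℓ' : ℝ) / ((m : ℝ) + 1)) ^ creg)
    {α : ℝ} (hα : 0 < α) (hα' : α ≤ 1 / 16) {ℓ' : ℕ} (hℓ' : 0 < ℓ') (hℓ'L : ℓ' ≤ ℓ + 1)
    (hαβ : α ≤ Real.pi / ℓ') :
    dklmMeasure c hc ℓ {p : ℝ × ℝ | p.1 ∈ Ioo 0 α ∧ |p.2| ∈ Icc (Real.pi / (2 * ℓ')) (2 * (Real.pi / (2 * ℓ')))} ≤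
      ENNReal.ofReal (4 / 3 * Creg * Real.pi ^ creg * (α / (Real.pi / (2 * ℓ'))) ^ creg) := by
  set K : ℕ := 2 * ⌈(4 * α)⁻¹⌉₊ with hK
  have hKpos : 0 < ⌈(4 * α)⁻¹⌉₊ := Nat.ceil_pos.2 (by positivity)
  obtain ⟨m, hm⟩ : ∃ m : ℕ, K = m + 1 := ⟨K - 1, by omega⟩
  have hK1 : (2 * α)⁻¹ ≤ (K : ℝ) := by
    rw [hK]; push_cast
    have := Nat.le_ceil ((4 * α)⁻¹)
    rw [show (2 * α)⁻¹ = 2 * (4 * α)⁻¹ by field_simp; ring]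
    linarith
  have hKm : (K : ℝ) = (m : ℝ) + 1 := by rw [hm]; push_cast; ring
  have hℓ'r : (0 : ℝ) < ℓ' := by exact_mod_cast hℓ'
  set β : ℝ := Real.pi / (2 * ℓ') with hβ
  have hβ0 : 0 < β := by positivity
  -- `ℓ' ≤ 8k`
  have h8 : (ℓ' : ℝ) ≤ 8 * ((m : ℝ) + 1) := by
    rw [← hKm]
    have e : (ℓ' : ℝ) ≤ Real.pi / α := by rwa [le_div_iff₀ hα, ← le_div_iff₀' hℓ'r]
    calc (ℓ' : ℝ) ≤ Real.pi / α := e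
      _ ≤ 4 / α := by gcongr; exact Real.pi_le_four
      _ = 8 * (2 * α)⁻¹ := by field_simp; ring
      _ ≤ 8 * K := by gcongr
  -- the comparison function `g(a,b) = (1-a)^K · 2(1 - cos ℓ'b)`
  set g : ℝ × ℝ → ℝ := fun p => (1 - p.1) ^ K * (2 * (1 - Real.cos (ℓ' * p.2))) with hg
  have hKeven : Even K := ⟨⌈(4 * α)⁻¹⌉₊, by rw [hK]; ring⟩
  have hg0 : ∀ p : ℝ × ℝ, 0 ≤ g p := fun p =>
    mul_nonneg (hKeven.pow_nonneg _) (by linarith [Real.cos_le_one (ℓ' * p.2)])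
  have hgsymm : ∀ a b : ℝ, g (a, -b) = g (a, b) := fun a b => by simp only [hg, mul_neg, Real.cos_neg]
  have hsum : ∑ k, dklmWeight c hc ℓ k / 2 * (g (dklmAtomA c ℓ k, dklmPhaseB c ℓ k) + g (dklmAtomA c ℓ k, -dklmPhaseB c ℓ k)) =
      phiVer c ℓ m ℓ' := by
    rw [phiVer_eq c hc ℓ m ℓ', ← hm]
    refine Finset.sum_congr rfl fun k _ => ?_
    rw [hgsymm]
    simp only [hg]
    ring
  refine (dklmMeasure_le_of_indicator_le c hc ℓ (g := g) (m := 3 / 4) (by norm_num) (fun k => ⟨hg0 _, hg0 _⟩)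
    (fun k σ hp => ?_)).trans ?_
  · -- on the box, `g ≥ 3/4`
    obtain ⟨⟨ha0, haα⟩, hb1, hb2⟩ := hp
    simp only [hg]
    have hθ : |(ℓ' : ℝ) * ((if σ then 1 else -1) * dklmPhaseB c ℓ k)| = ℓ' * |(if σ then 1 else -1) * dklmPhaseB c ℓ k| := by
      rw [abs_mul, abs_of_pos hℓ'r]
    refine box_integrand_ge hα hα' ha0.le haα.le ?_ ?_
    · rw [hθ]
      calc Real.pi / 2 = ℓ' * β := by rw [hβ]; field_simp
        _ ≤ _ := by gcongr
    · rw [hθ]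
      calc (ℓ' : ℝ) * |(if σ then 1 else -1) * dklmPhaseB c ℓ k| ≤ ℓ' * (2 * β) := by gcongr
        _ = Real.pi := by rw [hβ]; field_simp
  · rw [hsum]
    have hX : 0 < ((ℓ' : ℝ) / ((m : ℝ) + 1)) ^ creg := Real.rpow_pos_of_pos (by positivity) _
    have hR := hRb m ℓ' hℓ' h8 hℓ'L
    have hC0 : 0 ≤ Creg := (mul_nonneg_iff_of_pos_right hX).1 ((abs_nonneg _).trans hR)
    refine ENNReal.ofReal_le_ofReal ?_
    rw [show (4 : ℝ) / 3 * Creg * Real.pi ^ creg * (α / β) ^ creg = (3 / 4)⁻¹ * (Creg * (Real.pi ^ creg * (α / β) ^ creg)) by ring]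
    refine mul_le_mul_of_nonneg_left ((le_abs_self _).trans (hR.trans ?_)) (by norm_num)
    rw [← Real.mul_rpow (by positivity) (by positivity)]
    refine mul_le_mul_of_nonneg_left (Real.rpow_le_rpow (by positivity) ?_ hcreg) hC0
    rw [← hKm, div_le_iff₀ (by positivity : (0 : ℝ) < K)]
    calc (ℓ' : ℝ) = Real.pi / (2 * β) := by rw [hβ]; field_simp
      _ = Real.pi * (α / β) * (2 * α)⁻¹ := by field_simp
      _ ≤ Real.pi * (α / β) * K := by gcongr

end Step2

/-! ## 6. From the discrete bounds to Definition 29 ("simple algebraic manipulations") -/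

section General

variable (c : ℝ) (hc : 0 < c) (ℓ : ℕ)

include hc

/-- Outside the support: sets of points with `|b| > π` are `μ_L`-null. [cite: DKLM2026SixVertexGFF, Theorem 23] -/
theorem dklmMeasure_null_of_pi_lt {s : Set (ℝ × ℝ)} (hs : ∀ p ∈ s, Real.pi < |p.2|) : dklmMeasure c hc ℓ s = 0 := by
  refine measure_mono_null (fun p hp => ?_) (dklmMeasure_compl_support c hc ℓ)
  rw [mem_compl_iff, mem_prod]
  rintro ⟨-, hb⟩
  have := abs_le.2 ⟨by linarith [hb.1], hb.2⟩
  linarith [hs p hp]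

/-- **Bound (ii) of Definition 29 for `μ_L`, `α ≤ 1/16`, all `β ≥ α`**, given the second display of
Corollary 18: `μ_L{(a,|b|) ∈ (0,α) × (β,2β)} ≤ (8/3) C π^{c'} (2α/β)^{c'}`. The window `(β,2β)` is
empty above `π`, null below `2π/L`, and otherwise covered by the two closed windows `[π/2ℓ₁, π/ℓ₁]`,
`[π/2(ℓ₁-1), π/(ℓ₁-1)]`, `ℓ₁ = ⌈π/2β⌉ ≤ L/2`, whose base points are `≥ β/2`.
[cite: DKLM2026SixVertexGFF, Lemma 30 (proof, Step 2: "simple algebraic manipulations")] -/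
theorem dklmMeasure_bound_ii_small_of_regularity {Creg creg : ℝ} (hcreg : 0 ≤ creg)
    (hRb : ∀ m ℓ' : ℕ, 0 < ℓ' → (ℓ' : ℝ) ≤ 8 * ((m : ℝ) + 1) → ℓ' ≤ ℓ + 1 →
      |phiVer c ℓ m ℓ'| ≤ Creg * ((ℓ' : ℝ) / ((m : ℝ) + 1)) ^ creg)
    {α β : ℝ} (hα : 0 < α) (hα' : α ≤ 1 / 16) (hαβ : α ≤ β) :
    dklmMeasure c hc ℓ {p : ℝ × ℝ | p.1 ∈ Ioo 0 α ∧ |p.2| ∈ Ioo β (2 * β)} ≤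
      ENNReal.ofReal (2 * (4 / 3 * Creg * Real.pi ^ creg * (2 * α / β) ^ creg)) := by
  have hβ0 : 0 < β := hα.trans_le hαβ
  set S : Set (ℝ × ℝ) := {p : ℝ × ℝ | p.1 ∈ Ioo 0 α ∧ |p.2| ∈ Ioo β (2 * β)} with hS
  set Bnd : ℝ := 4 / 3 * Creg * Real.pi ^ creg * (2 * α / β) ^ creg with hBnd
  -- Case 1: `β ≥ π`: no support
  by_cases hπ : Real.pi ≤ β
  · rw [dklmMeasure_null_of_pi_lt c hc ℓ (s := S) fun p hp => by linarith [hp.2.1]]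
    exact zero_le
  push Not at hπ
  -- Case 2: `2β ≤ 2π/L`: no mass at small nonzero phases
  by_cases hsmall : 2 * β ≤ 2 * Real.pi / (2 * ((ℓ : ℝ) + 1))
  · have : dklmMeasure c hc ℓ S = 0 := by
      refine measure_mono_null ?_ (dklmMeasure_smallPhase c hc ℓ)
      intro p hp
      refine ⟨by linarith [hp.2.1, hβ0], ?_⟩
      have := hp.2.2
      linarith
    rw [this]; exact zero_le
  push Not at hsmall
  -- Case 3: two closed windows
  have hC0 : 0 ≤ Creg := by
    have hR := hRb 0 1 one_pos (by norm_num) (by omega)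
    have hX : 0 < (((1 : ℕ) : ℝ) / (((0 : ℕ) : ℝ) + 1)) ^ creg := Real.rpow_pos_of_pos (by norm_num) _
    exact (mul_nonneg_iff_of_pos_right hX).1 ((abs_nonneg _).trans hR)
  have hBnd0 : 0 ≤ Bnd := by positivity
  set x : ℝ := Real.pi / (2 * β) with hx
  have hx0 : 1 / 2 < x := by rw [hx, lt_div_iff₀ (by positivity)]; linarith
  set ℓ₁ : ℕ := ⌈x⌉₊ with hℓ₁
  have hℓ₁pos : 0 < ℓ₁ := Nat.ceil_pos.2 (by linarith)
  have hℓ₁x : x ≤ ℓ₁ := Nat.le_ceil x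
  have hℓ₁x' : (ℓ₁ : ℝ) < x + 1 := Nat.ceil_lt_add_one (by linarith)
  have hxL : x < (ℓ : ℝ) + 1 := by
    rw [hx, div_lt_iff₀ (by positivity)]
    rw [div_lt_iff₀ (by positivity)] at hsmall
    nlinarith [Real.pi_pos]
  have hℓ₁L : ℓ₁ ≤ ℓ + 1 := by
    rw [hℓ₁, Nat.ceil_le]
    exact_mod_cast hxL.le
  have hβ₁ : β / 2 ≤ Real.pi / (2 * ℓ₁) := by
    rw [div_le_div_iff₀ (by norm_num) (by positivity)]
    have hlt : (ℓ₁ : ℝ) * β < Real.pi / 2 + β := by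
      calc (ℓ₁ : ℝ) * β < (x + 1) * β := by gcongr
        _ = Real.pi / 2 + β := by rw [hx]; field_simp
    by_cases h1 : ℓ₁ = 1
    · rw [h1]; push_cast; nlinarith
    · -- `ℓ₁ ≥ 2` forces `x > 1`, i.e. `β < π/2`
      have h2 : ¬(ℓ₁ ≤ 1) := by omega
      rw [hℓ₁, Nat.ceil_le, Nat.cast_one, not_le] at h2
      have hβπ : 2 * β < Real.pi := by
        rw [hx, lt_div_iff₀ (by positivity)] at h2; linarith
      nlinarith
  have cover_low : Real.pi / (2 * ℓ₁) ≤ β := by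
    rw [div_le_iff₀ (by positivity)]
    have := hℓ₁x
    rw [hx, div_le_iff₀ (by positivity)] at this
    linarith
  -- generic window bound
  have hwin : ∀ ℓ' : ℕ, 0 < ℓ' → ℓ' ≤ ℓ + 1 → β / 2 ≤ Real.pi / (2 * ℓ') →
      dklmMeasure c hc ℓ {p : ℝ × ℝ | p.1 ∈ Ioo 0 α ∧ |p.2| ∈ Icc (Real.pi / (2 * ℓ')) (2 * (Real.pi / (2 * ℓ')))} ≤
        ENNReal.ofReal Bnd := by
    intro ℓ' hℓ' hℓ'L hb
    have hℓ'r : (0 : ℝ) < ℓ' := by exact_mod_cast hℓ'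
    have hαβ' : α ≤ Real.pi / ℓ' := by
      calc α ≤ β := hαβ
        _ = 2 * (β / 2) := by ring
        _ ≤ 2 * (Real.pi / (2 * ℓ')) := by gcongr
        _ = Real.pi / ℓ' := by field_simp
    refine (dklmMeasure_box_le_of_regularity c hc ℓ hcreg hRb hα hα' hℓ' hℓ'L hαβ').trans (ENNReal.ofReal_le_ofReal ?_)
    rw [hBnd]
    refine mul_le_mul_of_nonneg_left (Real.rpow_le_rpow (by positivity) ?_ hcreg) (by positivity)
    calc α / (Real.pi / (2 * ℓ')) ≤ α / (β / 2) := div_le_div_of_nonneg_left hα.le (by positivity) hb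
      _ = 2 * α / β := by field_simp
  set T : Set (ℝ × ℝ) := {p : ℝ × ℝ | Real.pi < |p.2|} with hTdef
  have hT : dklmMeasure c hc ℓ T = 0 := dklmMeasure_null_of_pi_lt c hc ℓ fun p hp => hp
  have hW₁ := hwin ℓ₁ hℓ₁pos hℓ₁L hβ₁
  set W₁ : Set (ℝ × ℝ) := {p : ℝ × ℝ | p.1 ∈ Set.Ioo 0 α ∧ |p.2| ∈ Set.Icc (Real.pi / (2 * ℓ₁)) (2 * (Real.pi / (2 * ℓ₁)))}
    with hW₁def
  by_cases h1 : ℓ₁ = 1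
  · have hsub : S ⊆ W₁ ∪ T := by
      intro p hp
      by_cases hb : |p.2| ≤ Real.pi
      · left
        refine ⟨hp.1, cover_low.trans hp.2.1.le, ?_⟩
        have e : 2 * (Real.pi / (2 * (ℓ₁ : ℝ))) = Real.pi := by rw [h1]; push_cast; ring
        rw [e]; exact hb
      · right; exact not_le.1 hb
    calc dklmMeasure c hc ℓ S ≤ dklmMeasure c hc ℓ (W₁ ∪ T) := measure_mono hsub
      _ ≤ dklmMeasure c hc ℓ W₁ + dklmMeasure c hc ℓ T := measure_union_le _ _
      _ ≤ ENNReal.ofReal Bnd + 0 := add_le_add hW₁ hT.le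
      _ ≤ ENNReal.ofReal (2 * Bnd) := by rw [add_zero]; exact ENNReal.ofReal_le_ofReal (by linarith)
  · have h2 : 2 ≤ ℓ₁ := by omega
    set ℓ₂ : ℕ := ℓ₁ - 1 with hℓ₂
    have hℓ₂pos : 0 < ℓ₂ := by omega
    have hℓ₂r : (0 : ℝ) < ℓ₂ := by exact_mod_cast hℓ₂pos
    have e12 : (ℓ₁ : ℝ) = (ℓ₂ : ℝ) + 1 := by
      have : ℓ₁ = ℓ₂ + 1 := by omega
      rw [this]; push_cast; ring
    have hℓ₂L : ℓ₂ ≤ ℓ + 1 := by omega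
    have hmono : Real.pi / (2 * ℓ₁) ≤ Real.pi / (2 * ℓ₂) :=
      div_le_div_of_nonneg_left Real.pi_pos.le (by positivity) (by rw [e12]; linarith)
    have hβ₂ : β / 2 ≤ Real.pi / (2 * ℓ₂) := hβ₁.trans hmono
    have hW₂ := hwin ℓ₂ hℓ₂pos hℓ₂L hβ₂
    set W₂ : Set (ℝ × ℝ) := {p : ℝ × ℝ | p.1 ∈ Set.Ioo 0 α ∧ |p.2| ∈ Set.Icc (Real.pi / (2 * ℓ₂)) (2 * (Real.pi / (2 * ℓ₂)))}
      with hW₂def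
    have hsub : S ⊆ (W₁ ∪ W₂) ∪ T := by
      intro p hp
      by_cases hb : |p.2| ≤ Real.pi
      · left
        by_cases hb1 : |p.2| ≤ 2 * (Real.pi / (2 * ℓ₁))
        · left; exact ⟨hp.1, cover_low.trans hp.2.1.le, hb1⟩
        · right
          push Not at hb1
          refine ⟨hp.1, ?_, ?_⟩
          · have : Real.pi / (2 * ℓ₂) ≤ 2 * (Real.pi / (2 * ℓ₁)) := by
              have h1le : (1 : ℝ) ≤ ℓ₂ := by exact_mod_cast hℓ₂pos
              calc Real.pi / (2 * ℓ₂) ≤ Real.pi / (ℓ₂ + 1) :=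
                    div_le_div_of_nonneg_left Real.pi_pos.le (by positivity) (by linarith)
                _ = 2 * (Real.pi / (2 * ℓ₁)) := by rw [e12]; field_simp
            linarith
          · have hℓ₂x : (ℓ₂ : ℝ) ≤ x := by linarith
            have : 2 * β ≤ 2 * (Real.pi / (2 * ℓ₂)) := by
              rw [show 2 * (Real.pi / (2 * (ℓ₂ : ℝ))) = Real.pi / ℓ₂ by ring, le_div_iff₀ hℓ₂r]
              rw [hx, le_div_iff₀ (by positivity)] at hℓ₂x
              linarith
            linarith [hp.2.2]
      · right; exact not_le.1 hb
    calc dklmMeasure c hc ℓ S ≤ dklmMeasure c hc ℓ ((W₁ ∪ W₂) ∪ T) := measure_mono hsub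
      _ ≤ dklmMeasure c hc ℓ (W₁ ∪ W₂) + dklmMeasure c hc ℓ T := measure_union_le _ _
      _ ≤ (dklmMeasure c hc ℓ W₁ + dklmMeasure c hc ℓ W₂) + dklmMeasure c hc ℓ T :=
          add_le_add (measure_union_le W₁ W₂) le_rfl
      _ ≤ (ENNReal.ofReal Bnd + ENNReal.ofReal Bnd) + 0 := add_le_add (add_le_add hW₁ hW₂) hT.le
      _ = ENNReal.ofReal (2 * Bnd) := by rw [add_zero, ← ENNReal.ofReal_add hBnd0 hBnd0, two_mul]

/-- **Bound (ii) of Definition 29 for `μ_L`, all `β ≥ α > 0`**, given the second display of Corollary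
18: `μ_L{(a,|b|) ∈ (0,α) × (β,2β)} ≤ ((8/3) C π^{c'} 2^{c'} + 256 (16π)^{c'}) (α/β)^{c'}` (for
`α > 1/16` the window is split into `{a < 1/16}` and `{a ≥ 1/16}`, the latter of mass `≤ 256`, and
`16π α/β ≥ 1` unless the window lies above `π`). [cite: DKLM2026SixVertexGFF, Lemma 30 (proof, Step 2)] -/
theorem dklmMeasure_bound_ii_of_regularity {Creg creg : ℝ} (hcreg : 0 ≤ creg)
    (hRb : ∀ m ℓ' : ℕ, 0 < ℓ' → (ℓ' : ℝ) ≤ 8 * ((m : ℝ) + 1) → ℓ' ≤ ℓ + 1 →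
      |phiVer c ℓ m ℓ'| ≤ Creg * ((ℓ' : ℝ) / ((m : ℝ) + 1)) ^ creg)
    {α β : ℝ} (hα : 0 < α) (hαβ : α ≤ β) :
    dklmMeasure c hc ℓ {p : ℝ × ℝ | p.1 ∈ Ioo 0 α ∧ |p.2| ∈ Ioo β (2 * β)} ≤
      ENNReal.ofReal ((2 * (4 / 3 * Creg * Real.pi ^ creg * 2 ^ creg) + 256 * (16 * Real.pi) ^ creg) * (α / β) ^ creg) := by
  have hβ0 : 0 < β := hα.trans_le hαβ
  have hC0 : 0 ≤ Creg := by
    have hR := hRb 0 1 one_pos (by norm_num) (by omega)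
    have hX : 0 < (((1 : ℕ) : ℝ) / (((0 : ℕ) : ℝ) + 1)) ^ creg := Real.rpow_pos_of_pos (by norm_num) _
    exact (mul_nonneg_iff_of_pos_right hX).1 ((abs_nonneg _).trans hR)
  have hsplit : ∀ {α' : ℝ}, 0 < α' → 2 * (4 / 3 * Creg * Real.pi ^ creg * (2 * α' / β) ^ creg) =
      2 * (4 / 3 * Creg * Real.pi ^ creg * 2 ^ creg) * (α' / β) ^ creg := by
    intro α' hα'
    rw [show 2 * α' / β = 2 * (α' / β) by ring, Real.mul_rpow (by norm_num) (by positivity)]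
    ring
  by_cases hα16 : α ≤ 1 / 16
  · refine (dklmMeasure_bound_ii_small_of_regularity c hc ℓ hcreg hRb hα hα16 hαβ).trans (ENNReal.ofReal_le_ofReal ?_)
    rw [hsplit hα, add_mul]
    have : 0 ≤ 256 * (16 * Real.pi) ^ creg * (α / β) ^ creg := by positivity
    linarith
  push Not at hα16
  by_cases hπ : Real.pi ≤ β
  · rw [dklmMeasure_null_of_pi_lt c hc ℓ (fun p hp => by linarith [hp.2.1])]
    exact zero_le
  push Not at hπ
  have h16 : (1 : ℝ) / 16 ≤ β := by linarith
  have hsub : {p : ℝ × ℝ | p.1 ∈ Set.Ioo 0 α ∧ |p.2| ∈ Set.Ioo β (2 * β)} ⊆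
      {p : ℝ × ℝ | p.1 ∈ Set.Ioo 0 (1 / 16) ∧ |p.2| ∈ Set.Ioo β (2 * β)} ∪ {p : ℝ × ℝ | (1 : ℝ) / 16 ≤ p.1} := by
    intro p hp
    by_cases ha : p.1 < 1 / 16
    · exact Or.inl ⟨⟨hp.1.1, ha⟩, hp.2⟩
    · exact Or.inr (not_lt.1 ha)
  have hone : (1 : ℝ) ≤ (16 * Real.pi) ^ creg * (α / β) ^ creg := by
    rw [← Real.mul_rpow (by positivity) (by positivity)]
    refine Real.one_le_rpow ?_ hcreg
    rw [show 16 * Real.pi * (α / β) = (16 * α) * (Real.pi / β) by ring]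
    exact one_le_mul_of_one_le_of_one_le (by linarith) ((one_le_div hβ0).2 hπ.le)
  refine (measure_mono hsub).trans ((measure_union_le _ _).trans ?_)
  refine (add_le_add (dklmMeasure_bound_ii_small_of_regularity c hc ℓ hcreg hRb (by norm_num) le_rfl h16)
    (dklmMeasure_ge_le_inv_sq c hc ℓ (by norm_num : (0 : ℝ) < 1 / 16))).trans ?_
  · rw [← ENNReal.ofReal_add (by positivity) (by positivity)]
    refine ENNReal.ofReal_le_ofReal ?_
    rw [hsplit (by norm_num : (0 : ℝ) < 1 / 16), add_mul]
    refine add_le_add ?_ ?_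
    · refine mul_le_mul_of_nonneg_left (Real.rpow_le_rpow (by positivity) ?_ hcreg) (by positivity)
      exact div_le_div_of_nonneg_right hα16.le hβ0.le
    · rw [mul_assoc]
      have : ((1 : ℝ) / 16) ^ 2 = 256⁻¹ := by norm_num
      rw [this, inv_inv]
      nlinarith

/-- **Lemma 30 (`μ_L ∈ 𝓜_{c,C}`), conditional on Corollary 18**: if the two displays of the cylinder
regularity estimate hold with constants `C_reg`, `c_reg ≥ 0` (at this `L`), then `μ_L` belongs to
`𝓜_{c_reg, C'}` (Definition 29) with the explicit, `L`-independent
`C' = max(max(162 C_reg, 256), (8/3) C_reg π^{c} 2^{c} + 256 (16π)^{c})`.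
[cite: DKLM2026SixVertexGFF, Lemma 30 and Corollary 18] -/
theorem dklmMeasure_mem_dklmSpaceM_of_regularity {Creg creg : ℝ} (hcreg : 0 ≤ creg)
    (hRa : ∀ m : ℕ, |phiHor c ℓ m| ≤ Creg)
    (hRb : ∀ m ℓ' : ℕ, 0 < ℓ' → (ℓ' : ℝ) ≤ 8 * ((m : ℝ) + 1) → ℓ' ≤ ℓ + 1 →
      |phiVer c ℓ m ℓ'| ≤ Creg * ((ℓ' : ℝ) / ((m : ℝ) + 1)) ^ creg) :
    dklmMeasure c hc ℓ ∈ dklmSpaceM creg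
      (max (max (162 * Creg) 256) (2 * (4 / 3 * Creg * Real.pi ^ creg * 2 ^ creg) + 256 * (16 * Real.pi) ^ creg)) := by
  refine ⟨?_, dklmMeasure_map_reflect c hc ℓ, fun α hα => ?_, fun α β hα hαβ => ?_⟩
  · refine measure_mono_null (fun p hp => ?_) (dklmMeasure_compl_support c hc ℓ)
    rw [mem_compl_iff, mem_prod]
    rintro ⟨ha, -⟩
    exact absurd ha.1 (not_lt.2 hp)
  · exact (dklmMeasure_bound_i_of_regularity c hc ℓ hRa hα).trans (ENNReal.ofReal_le_ofReal (le_max_left _ _))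
  · refine (dklmMeasure_bound_ii_of_regularity c hc ℓ hcreg hRb hα hαβ).trans (ENNReal.ofReal_le_ofReal ?_)
    exact mul_le_mul_of_nonneg_right (le_max_right _ _) (Real.rpow_nonneg (div_nonneg hα.le (hα.le.trans hαβ)) _)

end General

end Literature.Probability.LatticeModels.SixVertex

end
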